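import Summits.AtomisticToContinuum.BoseEinsteinCondensation.Theorems.BECRieszReverseHolderShadowCavityField
import Summits.AtomisticToContinuum.BoseEinsteinCondensation.Theorems.BECRieszReverseHolderCoarseGrainedReverseHolderStubRieszFieldMomentPinned
import HarnessLib

/-!
# Shadow certification T1: the one-cube insertion bound (route BECRieszReverseHolder)

Line `registered` of crux stmt-AtomisticToContinuum-12840 (`CoarseGrainedReverseHolder`); registered
sub-goal `shadow_insertionSq_le_twoPinned` (T1 of the certification of the variance functional on
the shadow/Jastrow state of the smeared Riesz-2 gas).

With `g = periodicRieszKernel 2 L η` (continuous, `|g| ≤ g(0)`, zero cell mean of every translate),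
`H_n(X) = Σ_{i<j} g(X_i - X_j)`, cavity field `h_X(y) = Σ_j g(y - X_j)`, coupling `b ≥ 0` and a
cube `Q` of the coarse graining, we prove
`∫_{cell^n} e^{-bH_n(X)} (∫_Q e^{-b h_X})² / (∫_{cell} e^{-b h_X}) dX
   ≤ (e^{b g(0)} / L³) ∫_Q ∫_Q ∫_{cell^n} e^{-b H_{n+2}(y :: y' :: X)} dX dy' dy`.

Proof. (1) Jensen: `∫_{cell} e^{-b h_X} ≥ L³` (`1 - u ≤ e^{-u}` and `∫_{cell} h_X = 0`,
`CoarseRH2.integral_cell_cavityField_eq_zero`). (2) `(∫_Q w)² = ∫_Q∫_Q w(y) w(y')`.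
(3) `H_{n+2}(y :: y' :: X) = g(y - y') + h_X(y) + h_X(y') + H_n(X)` (`pairSum_vecCons` twice) and
`g ≤ g(0)` give the pointwise bound
`e^{-bH_n(X)} e^{-b h_X(y)} e^{-b h_X(y')} ≤ e^{b g(0)} e^{-b H_{n+2}(y :: y' :: X)}`.
(4) Fubini for the bounded continuous integrand on the finite product `Q × Q × cell^n`.
The measure-theoretic skeleton is isolated in `ShadowInsertion.setIntegral_mul_sq_div_le`, which is
abstract in the weights.
-/

namespace Summit.AtomisticToContinuum.BoseEinsteinCondensation.Theorems.CoarseGrainedReverseHolder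

open MeasureTheory
open Literature.MathematicalPhysics.QuantumManyBody
open Literature.MathematicalPhysics.StatisticalMechanics
open BoseGas

namespace ShadowInsertion

variable {n : ℕ} {L : ℝ}

/-! ### Elementary bounds and the two-tagged-particle algebra -/

/-- `|Σ_{i ∈ s} f i| ≤ |s|·C` when `|f i| ≤ C` for all `i`. -/
theorem abs_sum_le_card_mul {ι : Type*} (s : Finset ι) (f : ι → ℝ) {C : ℝ} (hC : ∀ i, |f i| ≤ C) :
    |∑ i ∈ s, f i| ≤ s.card * C :=
  (Finset.abs_sum_le_sum_abs _ _).trans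
    ((Finset.sum_le_card_nsmul _ _ _ fun i _ => hC i).trans_eq (nsmul_eq_mul _ _))

/-- The pair energy of a kernel bounded by `C` is at most `N² C` in absolute value. -/
theorem abs_pairSum_le {N : ℕ} (u : Space → ℝ) {C : ℝ} (hC : ∀ z, |u z| ≤ C) (Y : Config N) :
    |∑ i : Fin N, ∑ j : Fin N with i < j, u (Y i - Y j)| ≤ (N : ℝ) ^ 2 * C := by
  have hC0 : 0 ≤ C := (abs_nonneg _).trans (hC 0)
  have hrow : ∀ i : Fin N, |∑ j : Fin N with i < j, u (Y i - Y j)| ≤ (N : ℝ) * C := fun i => by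
    refine (abs_sum_le_card_mul _ _ fun j => hC _).trans (mul_le_mul_of_nonneg_right ?_ hC0)
    exact_mod_cast (Finset.card_filter_le _ _).trans_eq (Finset.card_fin N)
  refine (abs_sum_le_card_mul _ _ hrow).trans_eq ?_
  rw [Finset.card_univ, Fintype.card_fin]
  ring

/-- The cavity field of a kernel bounded by `C` is at most `n C` in absolute value. -/
theorem abs_rowSum_le (u : Space → ℝ) {C : ℝ} (hC : ∀ z, |u z| ≤ C) (y : Space) (X : Config n) :
    |∑ j : Fin n, u (y - X j)| ≤ (n : ℝ) * C :=
  (abs_sum_le_card_mul _ _ fun j => hC _).trans_eq (by rw [Finset.card_univ, Fintype.card_fin])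

/-- Two tagged particles: `H_{n+2}(y :: y' :: X) = u(y - y') + h_X(y) + h_X(y') + H_n(X)`. -/
theorem pairSum_vecCons_vecCons (u : Space → ℝ) (y y' : Space) (X : Config n) :
    (∑ i : Fin (n + 2), ∑ j : Fin (n + 2) with i < j,
        u (Matrix.vecCons y (Matrix.vecCons y' X) i - Matrix.vecCons y (Matrix.vecCons y' X) j)) =
      u (y - y') + (∑ j : Fin n, u (y - X j)) + (∑ j : Fin n, u (y' - X j)) +
        ∑ i : Fin n, ∑ j : Fin n with i < j, u (X i - X j) := by
  rw [RieszFieldMoment.pairSum_vecCons u y (Matrix.vecCons y' X),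
    RieszFieldMoment.pairSum_vecCons u y' X, Fin.sum_univ_succ]
  simp only [Matrix.cons_val_zero, Matrix.cons_val_succ]
  ring

/-! ### Integrability and Fubini on the finite product `Q × Q × cell^n` -/

/-- A continuous function with `|f| ≤ C` is integrable for a finite measure. -/
theorem integrable_of_continuous_of_abs_le {α : Type*} [TopologicalSpace α] [MeasurableSpace α]
    [OpensMeasurableSpace α] {μ : Measure α} [IsFiniteMeasure μ] {f : α → ℝ} (hf : Continuous f)
    {C : ℝ} (hC : ∀ x, |f x| ≤ C) : Integrable f μ :=
  Integrable.of_bound hf.aestronglyMeasurable C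
    (ae_of_all _ fun x => (Real.norm_eq_abs _).trans_le (hC x))

/-- **First Jensen step**: `L³ ≤ ∫_{cell} e^{-w}` for an integrable zero-mean exponent `w` with
`e^{-w}` integrable (`1 - u ≤ e^{-u}` integrated over the cell). -/
theorem pow_le_setIntegral_exp_neg (hL : 0 < L) {w : Space → ℝ}
    (hint : IntegrableOn w (cell L) volume)
    (hexp : IntegrableOn (fun y => Real.exp (-w y)) (cell L) volume)
    (h0 : ∫ y in cell L, w y = 0) : L ^ 3 ≤ ∫ y in cell L, Real.exp (-w y) := by
  -- adapted from `CoarseRH2.ofReal_pow_le_setLIntegral_exp_neg` (Bochner form)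
  have hfin : volume (cell L) ≠ ⊤ := by
    rw [volume_cell]; exact ENNReal.pow_ne_top ENNReal.ofReal_ne_top
  have hvol : (volume (cell L)).toReal = L ^ 3 := by
    rw [volume_cell, ENNReal.toReal_pow, ENNReal.toReal_ofReal hL.le]
  have hone : IntegrableOn (fun _ : Space => (1 : ℝ)) (cell L) volume :=
    integrableOn_const (hs := hfin)
  calc L ^ 3 = ∫ y in cell L, ((1 : ℝ) - w y) := by
        rw [integral_sub hone hint, h0, sub_zero, setIntegral_const, measureReal_def, hvol,
          smul_eq_mul, mul_one]
    _ ≤ ∫ y in cell L, Real.exp (-w y) :=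
        integral_mono (hone.sub hint) hexp fun y => by linarith [Real.add_one_le_exp (-w y)]

/-- Monotonicity of the double cube integral against a bounded continuous majorant (the minorant
only needs to be non-negative). -/
theorem integral_integral_mono_of_continuous {Q : Set Space} (hQ : volume Q ≠ ⊤)
    {f G : Space → Space → ℝ} (hf : ∀ y y', 0 ≤ f y y')
    (hG : Continuous fun p : Space × Space => G p.1 p.2) {C : ℝ} (hC : ∀ y y', |G y y'| ≤ C)
    (hle : ∀ y y', f y y' ≤ G y y') :
    ∫ y in Q, ∫ y' in Q, f y y' ≤ ∫ y in Q, ∫ y' in Q, G y y' := by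
  haveI : IsFiniteMeasure (volume.restrict Q) := isFiniteMeasure_restrict.2 hQ
  have h2 : Integrable (fun p : Space × Space => G p.1 p.2)
      ((volume.restrict Q).prod (volume.restrict Q)) :=
    integrable_of_continuous_of_abs_le hG fun p => hC p.1 p.2
  have h1 : ∀ y, Integrable (G y) (volume.restrict Q) := fun y =>
    integrable_of_continuous_of_abs_le (hG.comp (continuous_const.prodMk continuous_id))
      fun y' => hC y y'
  refine integral_mono_of_nonneg (ae_of_all _ fun y => integral_nonneg fun y' => hf y y')
    h2.integral_prod_left (ae_of_all _ fun y => ?_)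
  exact integral_mono_of_nonneg (ae_of_all _ fun y' => hf y y') (h1 y)
    (ae_of_all _ fun y' => hle y y')

/-- **Fubini on `Q × Q × cell^n`** for a bounded continuous integrand `Φ(y, y', X)`: the parametric
double cube integral is integrable in `X`, and the `X`-integral may be moved innermost. -/
theorem integrable_and_setIntegral_cellN_swap {Q : Set Space} (hQ : volume Q ≠ ⊤) (L : ℝ)
    {Φ : Space → Space → Config n → ℝ}
    (hΦ : Continuous fun p : Config n × Space × Space => Φ p.2.1 p.2.2 p.1)
    {C : ℝ} (hC : ∀ y y' X, |Φ y y' X| ≤ C) :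
    Integrable (fun X => ∫ y in Q, ∫ y' in Q, Φ y y' X) (volume.restrict (cellN n L)) ∧
      ∫ X in cellN n L, ∫ y in Q, ∫ y' in Q, Φ y y' X =
        ∫ y in Q, ∫ y' in Q, ∫ X in cellN n L, Φ y y' X := by
  haveI : IsFiniteMeasure (volume.restrict Q) := isFiniteMeasure_restrict.2 hQ
  haveI : IsFiniteMeasure (volume.restrict (cellN n L)) := by
    refine isFiniteMeasure_restrict.2 ?_
    rw [volume_cellN]
    exact ENNReal.pow_ne_top (ENNReal.pow_ne_top ENNReal.ofReal_ne_top)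
  have h3 : Integrable (fun q : Config n × Space × Space => Φ q.2.1 q.2.2 q.1)
      ((volume.restrict (cellN n L)).prod ((volume.restrict Q).prod (volume.restrict Q))) :=
    integrable_of_continuous_of_abs_le hΦ fun q => hC _ _ _
  have h2 : ∀ X : Config n, Integrable (fun p : Space × Space => Φ p.1 p.2 X)
      ((volume.restrict Q).prod (volume.restrict Q)) := fun X =>
    integrable_of_continuous_of_abs_le (hΦ.comp (continuous_const.prodMk continuous_id))
      fun p => hC _ _ _
  have hprod : ∀ X : Config n,
      ∫ p, Φ p.1 p.2 X ∂((volume.restrict Q).prod (volume.restrict Q)) =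
        ∫ y in Q, ∫ y' in Q, Φ y y' X := fun X =>
    integral_prod (fun p : Space × Space => Φ p.1 p.2 X) (h2 X)
  refine ⟨h3.integral_prod_left.congr (ae_of_all _ fun X => hprod X), ?_⟩
  calc ∫ X in cellN n L, ∫ y in Q, ∫ y' in Q, Φ y y' X
      = ∫ X in cellN n L, ∫ p, Φ p.1 p.2 X ∂((volume.restrict Q).prod (volume.restrict Q)) :=
        integral_congr_ae (ae_of_all _ fun X => (hprod X).symm)
    _ = ∫ p, (∫ X in cellN n L, Φ p.1 p.2 X) ∂((volume.restrict Q).prod (volume.restrict Q)) :=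
        integral_integral_swap (f := fun X (p : Space × Space) => Φ p.1 p.2 X) h3
    _ = ∫ y in Q, ∫ y' in Q, ∫ X in cellN n L, Φ y y' X :=
        integral_prod (fun p : Space × Space => ∫ X in cellN n L, Φ p.1 p.2 X)
          h3.swap.integral_prod_left

/-! ### The abstract insertion bound -/

/-- **Abstract one-cube insertion bound.** For non-negative weights `w(X)`, `a(y, X)` with
`∫_{cell} a(·, X) ≥ Z₀ > 0` and a bounded continuous `Φ` with
`w(X) a(y, X) a(y', X) ≤ K Φ(y, y', X)` pointwise:
`∫_{cell^n} w (∫_Q a)² / (∫_{cell} a) ≤ (K / Z₀) ∫_Q ∫_Q ∫_{cell^n} Φ`. -/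
theorem setIntegral_mul_sq_div_le {Q : Set Space} (hQ : volume Q ≠ ⊤) (L : ℝ)
    {w : Config n → ℝ} {a : Space → Config n → ℝ} {Φ : Space → Space → Config n → ℝ} {K Z₀ C : ℝ}
    (hw : ∀ X, 0 ≤ w X) (ha : ∀ y X, 0 ≤ a y X) (hZ₀ : 0 < Z₀)
    (hZ : ∀ X, Z₀ ≤ ∫ y in cell L, a y X)
    (hΦ : Continuous fun p : Config n × Space × Space => Φ p.2.1 p.2.2 p.1)
    (hC : ∀ y y' X, |Φ y y' X| ≤ C)
    (hle : ∀ y y' X, w X * (a y X * a y' X) ≤ K * Φ y y' X) :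
    ∫ X in cellN n L, w X * (∫ y in Q, a y X) ^ 2 / (∫ y in cell L, a y X) ≤
      K / Z₀ * ∫ y in Q, ∫ y' in Q, ∫ X in cellN n L, Φ y y' X := by
  obtain ⟨hGi, hswap⟩ := integrable_and_setIntegral_cellN_swap hQ L hΦ hC
  -- the bound at a fixed environment `X`
  have hpt : ∀ X, w X * (∫ y in Q, a y X) ^ 2 / (∫ y in cell L, a y X) ≤
      K / Z₀ * ∫ y in Q, ∫ y' in Q, Φ y y' X := fun X => by
    have hsq : w X * (∫ y in Q, a y X) ^ 2 = ∫ y in Q, ∫ y' in Q, w X * (a y X * a y' X) := by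
      simp only [integral_const_mul, integral_mul_const]
      ring
    have hmono : ∫ y in Q, ∫ y' in Q, w X * (a y X * a y' X) ≤ ∫ y in Q, ∫ y' in Q, K * Φ y y' X :=
      integral_integral_mono_of_continuous hQ
        (fun y y' => mul_nonneg (hw X) (mul_nonneg (ha y X) (ha y' X)))
        (G := fun y y' => K * Φ y y' X)
        (continuous_const.mul (hΦ.comp (continuous_const.prodMk continuous_id)))
        (C := |K| * C)
        (fun y y' => by rw [abs_mul]; exact mul_le_mul_of_nonneg_left (hC y y' X) (abs_nonneg K))
        fun y y' => hle y y' X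
    have hKI : ∫ y in Q, ∫ y' in Q, K * Φ y y' X = K * ∫ y in Q, ∫ y' in Q, Φ y y' X := by
      simp only [integral_const_mul]
    have hnum : 0 ≤ w X * (∫ y in Q, a y X) ^ 2 := mul_nonneg (hw X) (sq_nonneg _)
    calc w X * (∫ y in Q, a y X) ^ 2 / (∫ y in cell L, a y X)
        ≤ w X * (∫ y in Q, a y X) ^ 2 / Z₀ := div_le_div_of_nonneg_left hnum hZ₀ (hZ X)
      _ = (∫ y in Q, ∫ y' in Q, w X * (a y X * a y' X)) / Z₀ := by rw [hsq]
      _ ≤ (K * ∫ y in Q, ∫ y' in Q, Φ y y' X) / Z₀ :=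
          div_le_div_of_nonneg_right (hmono.trans_eq hKI) hZ₀.le
      _ = K / Z₀ * ∫ y in Q, ∫ y' in Q, Φ y y' X := by ring
  -- integrate over the environment and swap
  have hnn : ∀ X, 0 ≤ w X * (∫ y in Q, a y X) ^ 2 / (∫ y in cell L, a y X) := fun X =>
    div_nonneg (mul_nonneg (hw X) (sq_nonneg _)) (integral_nonneg fun y => ha y X)
  calc ∫ X in cellN n L, w X * (∫ y in Q, a y X) ^ 2 / (∫ y in cell L, a y X)
      ≤ ∫ X in cellN n L, K / Z₀ * ∫ y in Q, ∫ y' in Q, Φ y y' X :=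
        integral_mono_of_nonneg (ae_of_all _ hnn) (hGi.const_mul _) (ae_of_all _ hpt)
    _ = K / Z₀ * ∫ y in Q, ∫ y' in Q, ∫ X in cellN n L, Φ y y' X := by
        rw [integral_const_mul, hswap]

end ShadowInsertion

open ShadowInsertion in
/-- **Shadow certification, T1 (one-cube insertion bound).** For `g = periodicRieszKernel 2 L η`,
`L > 0`, `b ≥ 0`, `η > 0`, every `n, m` and every cube `Q_k` of side `L/m`:
`∫_{cell^n} e^{-bH_n} (∫_{Q_k} e^{-b h_X})² / ∫_{cell} e^{-b h_X}
  ≤ (e^{b g(0)}/L³) ∫_{Q_k}∫_{Q_k}∫_{cell^n} e^{-b H_{n+2}(y :: y' :: X)}`. -/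
theorem shadow_insertionSq_le_twoPinned : ∀ (n m : ℕ) (L b η : ℝ), 0 < L → 0 ≤ b → 0 < η → ∀ g : BoseGas.Space → ℝ, g = periodicRieszKernel 2 L η → ∀ k : Fin 3 → Fin m, ∫ X in BoseGas.cellN n L, Real.exp (-(b * ∑ i : Fin n, ∑ j : Fin n with i < j, g (X i - X j))) * (∫ y in {y : EuclideanSpace ℝ (Fin 3) | ∀ i, y i ∈ Set.Ico ((k i : ℝ) * (L / m)) (((k i : ℝ) + 1) * (L / m))}, Real.exp (-(b * ∑ j : Fin n, g (y - X j)))) ^ 2 / (∫ y in BoseGas.cell L, Real.exp (-(b * ∑ j : Fin n, g (y - X j)))) ≤ Real.exp (b * g 0) / L ^ 3 * ∫ y in {y : EuclideanSpace ℝ (Fin 3) | ∀ i, y i ∈ Set.Ico ((k i : ℝ) * (L / m)) (((k i : ℝ) + 1) * (L / m))}, ∫ y' in {y : EuclideanSpace ℝ (Fin 3) | ∀ i, y i ∈ Set.Ico ((k i : ℝ) * (L / m)) (((k i : ℝ) + 1) * (L / m))}, ∫ X in BoseGas.cellN n L, Real.exp (-(b * ∑ i : Fin (n + 2), ∑ j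 : Fin (n + 2) with i < j, g (Matrix.vecCons y (Matrix.vecCons y' X) i - Matrix.vecCons y (Matrix.vecCons y' X) j))) := by
  intro n m L b η hL hb hη g hg k
  have hη' : η ≠ 0 := hη.ne'
  have hgc : Continuous g := by rw [hg]; exact continuous_periodicRieszKernel 2 hL hη'
  have hga : ∀ z, |g z| ≤ g 0 := fun z => by
    rw [hg]; exact abs_periodicRieszKernel_le two_pos hL hη' z
  have hg0 : ∀ z, g z ≤ g 0 := fun z => (le_abs_self _).trans (hga z)
  have hint : ∀ X : Config n,
      IntegrableOn (fun y : Space => b * ∑ j : Fin n, g (y - X j)) (cell L) volume := fun X => by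
    rw [hg]; exact CoarseRH2.integrableOn_cell_cavityField two_pos hL hη' b X
  have h0 : ∀ X : Config n, ∫ y in cell L, b * ∑ j : Fin n, g (y - X j) = 0 :=
    fun X => by rw [hg]; exact CoarseRH2.integral_cell_cavityField_eq_zero two_pos hL hη' b X
  have hcell : IsFiniteMeasure (volume.restrict (cell L)) := by
    refine isFiniteMeasure_restrict.2 ?_
    rw [volume_cell]
    exact ENNReal.pow_ne_top ENNReal.ofReal_ne_top
  have hQ : volume {y : EuclideanSpace ℝ (Fin 3) |
      ∀ i, y i ∈ Set.Ico ((k i : ℝ) * (L / m)) (((k i : ℝ) + 1) * (L / m))} ≠ ⊤ := by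
    rw [CoarseRH2.setOf_forall_mem_Ico_eq_subCell, CoarseRH2.volume_subCell]
    exact ENNReal.pow_ne_top ENNReal.ofReal_ne_top
  refine setIntegral_mul_sq_div_le hQ L (C := Real.exp (b * (((n + 2 : ℕ) : ℝ) ^ 2 * g 0)))
    (fun X => (Real.exp_pos _).le) (fun y X => (Real.exp_pos _).le) (by positivity) ?_ ?_ ?_ ?_
  · -- Jensen: `L³ ≤ ∫_{cell} e^{-b h_X}`
    intro X
    refine pow_le_setIntegral_exp_neg hL (hint X) ?_ (h0 X)
    refine integrable_of_continuous_of_abs_le (C := Real.exp (b * ((n : ℝ) * g 0))) (by fun_prop)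
      fun y => ?_
    rw [Real.abs_exp, Real.exp_le_exp, ← mul_neg]
    exact mul_le_mul_of_nonneg_left ((neg_le_abs _).trans (abs_rowSum_le g hga y X)) hb
  · -- continuity of the two-pinned weight
    fun_prop
  · -- boundedness of the two-pinned weight
    intro y y' X
    rw [Real.abs_exp, Real.exp_le_exp, ← mul_neg]
    exact mul_le_mul_of_nonneg_left ((neg_le_abs _).trans (abs_pairSum_le g hga _)) hb
  · -- the pointwise weight bound `e^{-bH_n} e^{-bh(y)} e^{-bh(y')} ≤ e^{b g 0} e^{-bH_{n+2}}`
    intro y y' X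
    simp only [← Real.exp_add, Real.exp_le_exp]
    rw [pairSum_vecCons_vecCons]
    have h1 := mul_le_mul_of_nonneg_left (hg0 (y - y')) hb
    nlinarith [h1]

end Summit.AtomisticToContinuum.BoseEinsteinCondensation.Theorems.CoarseGrainedReverseHolder
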